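import Summits.QuantumFields.YangMills.Theorems.PencilRigidityNPointIsotropyUnorderedRP
import Summits.QuantumFields.YangMills.Theorems.CurvatureSandwichBound.Negative.Unbundled
import Summits.QuantumFields.YangMills.Theorems.MirrorModularBoostsSoftKernelBoostCovarianceAsmSuperpositionTools
import Summits.QuantumFields.YangMills.Theorems.IsotropyFromPowerCountingCurvatureSandwichBoundChainEngine
import Literature.MathematicalPhysics.QuantumLattice.SchwingerOSCluster
import Mathlib.Analysis.SpecialFunctions.SmoothTransition
import HarnessLib

/-!
# Helpers for stub (F) `stub_diagOfBoxes` of line `Sketch` (crux `MirrorModularBoosts.SoftKernelBoostCovariance`)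

Support file for crux stmt-QuantumFields-14999, line `Sketch`, stub `stub_diagOfBoxes` (a sandwich bound for
box-localised insertions and compactly supported clouds is a sandwich bound).  Model-blind analysis for a
one-species family `S` on `ℝ⁴` with an `e₀`-reconstruction `hS`:

* `exists_bump`: a smooth telescoping partition of unity on `ℝ` (`θ t = ψ(t+1) − ψ(t)`, `ψ = Real.smoothTransition`;
  the partial sums `∑_{|i| ≤ M} θ(t − i) = ψ(t+M+1) − ψ(t−M) ∈ [0,1]` are `1` on `|t| ≤ M`);
* `hasTemperateGrowth_mult`, `exists_pieces`: the planar cut-offs `θ(x⁰/h − a) θ(x¹/h − b)` have temperate growth,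
  so the localised pieces of a Schwartz insertion are Schwartz (`SchwartzMap.smulLeftCLM`);
* `isTimeOrdered_insertion`: a windowed insertion in front of a translated time-ordered cloud is time-ordered;
* `piece_bound`: the sideways translation is free (`translate_fieldVec`, unitarity), so a box bound centred at
  `x¹ = 0` gives the bound for boxes centred anywhere;
* `tendsto_norm_fieldVec`: norms of regularised field vectors converge (`UnorderedRP.tendsto_osPairing`).
-/

noncomputable section

namespace Summit.QuantumFields.YangMills.Theorems.SoftKernelBoostCovariance.Sketch

namespace DiagOfBoxes

open scoped BigOperators SchwartzMap InnerProductSpace ContDiff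
open MeasureTheory Filter Topology
open Literature.MathematicalPhysics.QuantumLattice Literature.MathematicalPhysics.AQFT
  Literature.MathematicalPhysics.QuantumFieldTheory
open Summit.QuantumFields.YangMills.Theorems.NPointIsotropy.Negative (E4 NPointRegular)
open Summit.QuantumFields.YangMills.Theorems.CurvatureSandwichBound.Sketch
  (timeOrdered_of_head_tail re_pairing_self_eq_norm_sq tsupport_subset_window)
open Summit.QuantumFields.YangMills.Cruxes.PlanarSpectralCone.PositivityDiscToOperatorCone.Density
  (fieldVec_congr)

/-! ## 1. A telescoping partition of unity on `ℝ` -/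

/-- **Telescoping bump.**  There is a smooth compactly supported `θ : ℝ → [0,1]`, vanishing off `(-1, 1)`, whose
integer translates form a partition of unity with ALL partial sums in `[0,1]`:
`∑_{k < 2M+1} θ(t − (k − M)) ∈ [0,1]`, `= 1` for `|t| ≤ M` (`θ t = ψ(t+1) − ψ(t)` with `ψ = Real.smoothTransition`,
the sums telescope to `ψ(t+M+1) − ψ(t−M)`). -/
theorem exists_bump :
    ∃ θ : ℝ → ℝ, ContDiff ℝ ∞ θ ∧ HasCompactSupport θ ∧ (∀ t, 0 ≤ θ t) ∧ (∀ t, θ t ≤ 1) ∧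
      (∀ t, θ t ≠ 0 → |t| < 1) ∧
      ∀ (M : ℕ) (t : ℝ), (0 ≤ ∑ k ∈ Finset.range (2 * M + 1), θ (t - ((k : ℝ) - M))) ∧
        (∑ k ∈ Finset.range (2 * M + 1), θ (t - ((k : ℝ) - M)) ≤ 1) ∧
        (|t| ≤ M → ∑ k ∈ Finset.range (2 * M + 1), θ (t - ((k : ℝ) - M)) = 1) := by
  set θ : ℝ → ℝ := fun t => Real.smoothTransition (t + 1) - Real.smoothTransition t with hθ
  have hzero : ∀ t, (t ≤ -1 ∨ 1 ≤ t) → θ t = 0 := by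
    rintro t (ht | ht)
    · simp only [hθ]
      rw [Real.smoothTransition.zero_of_nonpos (by linarith), Real.smoothTransition.zero_of_nonpos (by linarith),
        sub_zero]
    · simp only [hθ]
      rw [Real.smoothTransition.one_of_one_le (by linarith), Real.smoothTransition.one_of_one_le ht, sub_self]
  have hsum : ∀ (M : ℕ) (t : ℝ), ∑ k ∈ Finset.range (2 * M + 1), θ (t - ((k : ℝ) - M)) =
      Real.smoothTransition (t + M + 1) - Real.smoothTransition (t - M) := by
    intro M t
    have h := Finset.sum_range_sub' (fun k : ℕ => Real.smoothTransition (t + M + 1 - k)) (2 * M + 1)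
    have hterm : ∀ k : ℕ, θ (t - ((k : ℝ) - M)) =
        Real.smoothTransition (t + M + 1 - k) - Real.smoothTransition (t + M + 1 - (k + 1 : ℕ)) := by
      intro k
      simp only [hθ]
      push_cast
      ring_nf
    simp only [hterm]
    rw [h]
    push_cast
    ring_nf
  refine ⟨θ, ?_, ?_, fun t => ?_, fun t => ?_, fun t ht => ?_, fun M t => ?_⟩
  · exact (Real.smoothTransition.contDiff.comp (contDiff_id.add contDiff_const)).sub
      Real.smoothTransition.contDiff
  · refine HasCompactSupport.intro (isCompact_Icc : IsCompact (Set.Icc (-1 : ℝ) 1)) fun t ht => hzero t ?_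
    simp only [Set.mem_Icc, not_and_or, not_le] at ht
    exact ht.imp le_of_lt le_of_lt
  · exact sub_nonneg.2 (Real.smoothTransition.monotone (by linarith))
  · simp only [hθ]
    linarith [Real.smoothTransition.le_one (t + 1), Real.smoothTransition.nonneg t]
  · by_contra hge
    rw [not_lt] at hge
    refine ht (hzero t ?_)
    rcases le_or_gt 0 t with h0 | h0
    · right; rwa [abs_of_nonneg h0] at hge
    · left; rw [abs_of_neg h0] at hge; linarith
  · rw [hsum]
    refine ⟨sub_nonneg.2 (Real.smoothTransition.monotone (by linarith)), by
      linarith [Real.smoothTransition.le_one (t + M + 1), Real.smoothTransition.nonneg (t - M)], fun ht => ?_⟩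
    rw [Real.smoothTransition.one_of_one_le (by linarith [(abs_le.1 ht).1]),
      Real.smoothTransition.zero_of_nonpos (by linarith [(abs_le.1 ht).2]), sub_zero]

/-! ## 2. The localised pieces of a Schwartz insertion -/

/-- The planar cut-off `x ↦ θ(x⁰/h − a) θ(x¹/h − b)` (as a complex multiplier on `(ℝ⁴)¹`) has temperate growth. -/
theorem hasTemperateGrowth_mult (θ : ℝ → ℝ) (hθ : ContDiff ℝ ∞ θ) (hθc : HasCompactSupport θ) (h a b : ℝ) :
    Function.HasTemperateGrowth
      (fun x : Fin 1 → E4 => ((θ (x 0 0 / h - a) * θ (x 0 1 / h - b) : ℝ) : ℂ)) := by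
  have hθt : Function.HasTemperateGrowth θ := hθc.hasTemperateGrowth hθ
  have hcoord : ∀ i : Fin 4, Function.HasTemperateGrowth (fun x : Fin 1 → E4 => x 0 i) := fun i =>
    ((EuclideanSpace.proj i).comp (ContinuousLinearMap.proj (R := ℝ) (φ := fun _ : Fin 1 => E4) 0)).hasTemperateGrowth
  have haff : ∀ (i : Fin 4) (c : ℝ), Function.HasTemperateGrowth (fun x : Fin 1 → E4 => x 0 i / h - c) := by
    intro i c
    have h1 : Function.HasTemperateGrowth (fun t : ℝ => t / h - c) := by
      have : (fun t : ℝ => t / h - c) = fun t => t * h⁻¹ - c := by funext t; rw [div_eq_mul_inv]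
      rw [this]
      fun_prop
    exact h1.comp (hcoord i)
  have h0 : Function.HasTemperateGrowth (fun x : Fin 1 → E4 => θ (x 0 0 / h - a)) := hθt.comp (haff 0 a)
  have h1 : Function.HasTemperateGrowth (fun x : Fin 1 → E4 => θ (x 0 1 / h - b)) := hθt.comp (haff 1 b)
  exact Function.Complex.hasTemperateGrowth_ofReal.comp (h0.mul h1)

/-- **Localised pieces are Schwartz**: `x ↦ θ(x⁰/h − a) θ(x¹/h − b) f₁ x` is a Schwartz function for every `a, b`. -/
theorem exists_pieces (θ : ℝ → ℝ) (hθ : ContDiff ℝ ∞ θ) (hθc : HasCompactSupport θ) (h : ℝ)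
    (f₁ : 𝓢((Fin 1 → E4), ℂ)) :
    ∃ fp : ℝ → ℝ → 𝓢((Fin 1 → E4), ℂ),
      ∀ a b x, fp a b x = ((θ (x 0 0 / h - a) * θ (x 0 1 / h - b) : ℝ) : ℂ) * f₁ x :=
  ⟨fun a b => SchwartzMap.smulLeftCLM ℂ
      (fun x : Fin 1 → E4 => ((θ (x 0 0 / h - a) * θ (x 0 1 / h - b) : ℝ) : ℂ)) f₁,
    fun a b x => by
      rw [SchwartzMap.smulLeftCLM_apply_apply (hasTemperateGrowth_mult θ hθ hθc h a b)]
      rfl⟩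

/-! ## 3. Windowed insertions in front of translated clouds are time-ordered -/

/-- **Time-ordering of a sandwiched vector's test function.**  If the insertion `f` is supported in the time
window `{u ≤ x⁰ ≤ 2u}` (`u > 0`) and `W` is time-ordered, then `f ⊗ T_{(2u+v)e₀} W` is time-ordered (`v > 0`):
the head sits at times `[u, 2u]`, the tail at times `> 2u + v`. -/
theorem isTimeOrdered_insertion {u v : ℝ} (hu : 0 < u) (hv : 0 < v) {f : 𝓢((Fin 1 → E4), ℂ)}
    (hf : tsupport (f : (Fin 1 → E4) → ℂ) ⊆ {x | u ≤ x 0 0 ∧ x 0 0 ≤ 2 * u}) {m : ℕ}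
    {W : 𝓢((Fin m → E4), ℂ)} (hW : IsTimeOrdered W) :
    IsTimeOrdered (f.appendTensor (translateMulti ((2 * u + v) • EuclideanSpace.single 0 1) W)) := by
  -- adapted from `CurvatureSandwichBound.Sketch.stub_chainOrdered`
  intro x hx
  obtain ⟨hxA, hxB⟩ := OSReconstructionNoE1.tsupport_appendTensor_subset _ _ hx
  have hf' : u ≤ x (Fin.castAdd m 0) 0 ∧ x (Fin.castAdd m 0) 0 ≤ 2 * u := hf hxA
  have hT : (∀ j, 0 < (x (Fin.natAdd 1 j) - (2 * u + v) • EuclideanSpace.single 0 1 : E4) 0) ∧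
      StrictMono fun j => (x (Fin.natAdd 1 j) - (2 * u + v) • EuclideanSpace.single 0 1 : E4) 0 :=
    hW (OSReconstructionNoE1.tsupport_translateMulti_subset _ _ hxB)
  have ha0 : ((2 * u + v) • EuclideanSpace.single 0 1 : E4) 0 = 2 * u + v := by simp
  simp only [PiLp.sub_apply, ha0] at hT
  refine timeOrdered_of_head_tail x (by linarith [hf'.1]) (fun j => ?_) (fun i j hij => ?_)
  · have := hT.1 j
    linarith [hf'.2]
  · have := hT.2 hij
    simp only at this
    linarith

/-- Translations preserve compact support. -/
theorem hasCompactSupport_translateMulti' {N : ℕ} (a : E4) {Y : 𝓢((Fin N → E4), ℂ)}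
    (hY : HasCompactSupport (Y : (Fin N → E4) → ℂ)) :
    HasCompactSupport ((translateMulti a Y : 𝓢((Fin N → E4), ℂ)) : (Fin N → E4) → ℂ) := by
  -- adapted from `…CurvatureBoostCovarianceOrbitLocalContinuation.hasCompactSupport_translateMulti`
  refine HasCompactSupport.intro
    (hY.image (continuous_pi fun i => (continuous_apply i).add continuous_const) :
      IsCompact ((fun y : Fin N → E4 => fun i => y i + a) '' tsupport (Y : (Fin N → E4) → ℂ)))
    fun y hy => ?_
  rw [translateMulti_apply]
  by_contra hne
  exact hy ⟨fun i => y i - a, subset_tsupport _ (Function.mem_support.2 hne), funext fun i => by simp⟩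

/-! ## 4. The sideways translation is free -/

/-- **A box bound centred at `x¹ = 0` gives the bound for boxes centred at any `x¹ = b`**, with the mass
`∫‖g‖ + ε` (any `ε > 0`).  The spatial translation `U(−b e₁)` is unitary and maps `Ψ_{f ⊗ T_sW}` to
`Ψ_{f(·+be₁) ⊗ T_s W(·+be₁)}` (`translate_fieldVec`, translations commute); the translated insertion is again a
product `g(x⁰, x¹+b) hh(x², x³)` with the same masses (translation invariance of Lebesgue measure on `ℝ²`), now
centred at `x¹ = 0`, and the translated cloud is time-ordered and compactly supported. -/
theorem piece_bound (S : SchwingerFamily E4) (hS : OSReconstructionNoE1 S.toLabelled) (μ CB : ℝ)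
    (hyp : ∀ (u v c : ℝ), 0 < u → 0 < v → u ≤ 1 → v ≤ 1 → u ≤ c → c + min u v / 32 ≤ 2 * u →
        ∀ (f : SchwartzMap (Fin 1 → E4) ℂ) (g hh : ℝ × ℝ → ℂ) (Mg Mh Mh' : ℝ),
          (∀ x, f x = g (x 0 0, x 0 1) * hh (x 0 2, x 0 3)) →
          (∀ p, g p ≠ 0 → (c ≤ p.1 ∧ p.1 ≤ c + min u v / 32) ∧ |p.2| ≤ min u v / 32) →
          MeasureTheory.Integrable g → (∫ p, ‖g p‖) ≤ Mg → 0 < Mg →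
          MeasureTheory.Integrable hh → (∫ p, ‖hh p‖) ≤ Mh → (∀ p, ‖hh p‖ ≤ Mh') →
        ∀ (n : ℕ) (W : SchwartzMap (Fin n → E4) ℂ) (hW : IsTimeOrdered W),
          HasCompactSupport (W : (Fin n → E4) → ℂ) →
        ∀ (hFW : IsTimeOrdered (f.appendTensor (translateMulti ((2 * u + v) • EuclideanSpace.single 0 1) W))),
          ‖hS.fieldVec (1 + n) (fun _ => ())
              (f.appendTensor (translateMulti ((2 * u + v) • EuclideanSpace.single 0 1) W)) hFW‖ ≤
            CB * Mg * (Mh + Mh') * (u ^ (-μ) + v ^ (-μ)) * ‖hS.fieldVec n (fun _ => ()) W hW‖)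
    {u v c b : ℝ} (hu : 0 < u) (hv : 0 < v) (hu1 : u ≤ 1) (hv1 : v ≤ 1) (huc : u ≤ c)
    (hc : c + min u v / 32 ≤ 2 * u)
    {f : 𝓢((Fin 1 → E4), ℂ)} {g hh : ℝ × ℝ → ℂ} {Mh Mh' ε : ℝ}
    (hf : ∀ x, f x = g (x 0 0, x 0 1) * hh (x 0 2, x 0 3))
    (hg : ∀ p, g p ≠ 0 → (c ≤ p.1 ∧ p.1 ≤ c + min u v / 32) ∧ |p.2 - b| ≤ min u v / 32)
    (hgi : Integrable g) (hhi : Integrable hh) (hhM : (∫ p, ‖hh p‖) ≤ Mh) (hhM' : ∀ p, ‖hh p‖ ≤ Mh')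
    (hε : 0 < ε) {n : ℕ} {W : 𝓢((Fin n → E4), ℂ)} (hW : IsTimeOrdered W)
    (hWc : HasCompactSupport (W : (Fin n → E4) → ℂ))
    (hFW : IsTimeOrdered (f.appendTensor (translateMulti ((2 * u + v) • EuclideanSpace.single 0 1) W))) :
    ‖hS.fieldVec (1 + n) (fun _ => ())
        (f.appendTensor (translateMulti ((2 * u + v) • EuclideanSpace.single 0 1) W)) hFW‖ ≤
      CB * ((∫ p, ‖g p‖) + ε) * (Mh + Mh') * (u ^ (-μ) + v ^ (-μ)) * ‖hS.fieldVec n (fun _ => ()) W hW‖ := by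
  -- the sideways shift `e = -b e₁`
  set e : E4 := -(b • EuclideanSpace.single 1 1) with he
  have he0 : e 0 = 0 := by simp [he]
  have he1 : e 1 = -b := by simp [he]
  have he2 : e 2 = 0 := by simp [he]
  have he3 : e 3 = 0 := by simp [he]
  have hsp : spatialPart 0 e = e := spatialPart_of_apply_eq_zero 0 he0
  set s : E4 := (2 * u + v) • EuclideanSpace.single 0 1 with hs
  -- translated data
  have hW' : IsTimeOrdered (translateMulti e W) :=
    OSReconstructionNoE1.isTimeOrdered_translateMulti hW (le_of_eq he0.symm)
  have hW'c : HasCompactSupport ((translateMulti e W : 𝓢((Fin n → E4), ℂ)) : (Fin n → E4) → ℂ) :=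
    hasCompactSupport_translateMulti' e hWc
  set g' : ℝ × ℝ → ℂ := fun p => g (p + (0, b)) with hg'def
  have hf' : ∀ x, translateMulti e f x = g' (x 0 0, x 0 1) * hh (x 0 2, x 0 3) := by
    intro x
    rw [translateMulti_apply, hf]
    simp only [hg'def, PiLp.sub_apply, he0, he1, he2, he3, sub_zero, sub_neg_eq_add, Prod.mk_add_mk, add_zero]
  have hg' : ∀ p, g' p ≠ 0 → (c ≤ p.1 ∧ p.1 ≤ c + min u v / 32) ∧ |p.2| ≤ min u v / 32 := by
    intro p hp
    have h1 := hg (p + (0, b)) hp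
    simpa using h1
  have hg'i : Integrable g' := hgi.comp_add_right (0, b)
  have hg'M : (∫ p, ‖g' p‖) ≤ (∫ p, ‖g p‖) + ε := by
    have h1 : (∫ p, ‖g' p‖) = ∫ p, ‖g p‖ := integral_add_right_eq_self (μ := volume) (fun p => ‖g p‖) (0, b)
    linarith
  have hMg' : 0 < (∫ p, ‖g p‖) + ε := by positivity
  -- time ordering of the translated sandwich test function
  have hδ0 : 0 ≤ min u v / 32 := by positivity
  have hwin : tsupport ((translateMulti e f : 𝓢((Fin 1 → E4), ℂ)) : (Fin 1 → E4) → ℂ) ⊆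
      {x | u ≤ x 0 0 ∧ x 0 0 ≤ 2 * u} :=
    tsupport_subset_window hf' fun p hp => ⟨huc.trans (hg' p hp).1.1, (hg' p hp).1.2.trans (by linarith)⟩
  have hX' : IsTimeOrdered ((translateMulti e f).appendTensor (translateMulti s (translateMulti e W))) :=
    isTimeOrdered_insertion hu hv hwin hW'
  -- the box hypothesis for the translated data
  have key := hyp u v c hu hv hu1 hv1 huc hc (translateMulti e f) g' hh _ Mh Mh' hf' hg' hg'i hg'M hMg'
    hhi hhM hhM' n (translateMulti e W) hW' hW'c hX'
  -- the norms are translation invariant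
  have hXeq : translateMulti (spatialPart 0 e) (f.appendTensor (translateMulti s W)) =
      (translateMulti e f).appendTensor (translateMulti s (translateMulti e W)) := by
    rw [hsp, translateMulti_appendTensor, translateMulti_translateMulti, translateMulti_translateMulti, add_comm e s]
  have h1 : ‖hS.fieldVec (1 + n) (fun _ => ()) (f.appendTensor (translateMulti s W)) hFW‖ =
      ‖hS.fieldVec (1 + n) (fun _ => ())
        ((translateMulti e f).appendTensor (translateMulti s (translateMulti e W))) hX'‖ := by
    rw [← (hS.translate e).norm_map, hS.translate_fieldVec]
    exact congrArg _ (fieldVec_congr hS hXeq _ _)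
  have h2 : ‖hS.fieldVec n (fun _ => ()) (translateMulti e W) hW'‖ = ‖hS.fieldVec n (fun _ => ()) W hW‖ := by
    rw [← (hS.translate e).norm_map (hS.fieldVec n (fun _ => ()) W hW), hS.translate_fieldVec]
    exact congrArg _ (fieldVec_congr hS (by rw [hsp]) _ _)
  rw [h1, ← h2]
  exact key

/-! ## 5. Norms of regularised field vectors converge -/

/-- **Norm convergence under the function residual.**  If `A_k = a_k · A` pointwise with time-ordered `A`, `A_k`,
multipliers `a_k ∈ [0,1]` eventually `1` at every point, then `‖Ψ_{A_k}‖ → ‖Ψ_A‖` for an `NPointRegular` family: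
`‖Ψ_F‖² = Re ⟪F, F⟫_S` and `UnorderedRP.tendsto_osPairing` (dominated convergence). -/
theorem tendsto_norm_fieldVec (S : SchwingerFamily E4) (hS : OSReconstructionNoE1 S.toLabelled)
    (hreg : NPointRegular S) {m : ℕ} {A : 𝓢((Fin m → E4), ℂ)} (hA : IsTimeOrdered A)
    (Ak : ℕ → 𝓢((Fin m → E4), ℂ)) (hAk : ∀ k, IsTimeOrdered (Ak k)) (a : ℕ → (Fin m → E4) → ℝ)
    (ha : ∀ k x, Ak k x = (a k x : ℂ) * A x) (ha01 : ∀ k x, 0 ≤ a k x ∧ a k x ≤ 1)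
    (ha1 : ∀ x, ∀ᶠ k in atTop, a k x = 1) :
    Tendsto (fun k => ‖hS.fieldVec m (fun _ => ()) (Ak k) (hAk k)‖) atTop
      (𝓝 ‖hS.fieldVec m (fun _ => ()) A hA‖) := by
  have hlim := Summit.QuantumFields.YangMills.Theorems.NPointIsotropy.QuarterTurnCornerOperator.UnorderedRP.tendsto_osPairing
    S hreg hA.isPositiveTimeMulti hA.isOffDiagonal hA.isPositiveTimeMulti hA.isOffDiagonal Ak Ak
    (fun k => (hAk k).isPositiveTimeMulti) (fun k => (hAk k).isOffDiagonal)
    (fun k => (hAk k).isPositiveTimeMulti) (fun k => (hAk k).isOffDiagonal) a a ha ha 1 1 ha01 ha01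
    (fun x _ => ha1 x) (fun x _ => ha1 x)
  have hnorm : ∀ (F : 𝓢((Fin m → E4), ℂ)) (hF : IsTimeOrdered F),
      ‖hS.fieldVec m (fun _ => ()) F hF‖ = Real.sqrt (S.osPairing F F).re := by
    intro F hF
    rw [show S.osPairing F F = S (m + m) ((osAdjoint F).appendTensor F) from rfl,
      re_pairing_self_eq_norm_sq S hS F hF, Real.sqrt_sq (norm_nonneg _)]
  simp only [hnorm]
  exact ((Complex.continuous_re.tendsto _).comp hlim).sqrt

/-! ## 6. Bookkeeping: masses of the pieces, sums of field vectors, cut-off clouds -/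

/-- **The masses of the pieces add up**: `∑_{k,l} ∫ |θ_k θ_l g| ≤ ∫ |g|` for cut-offs with partial sums `≤ 1`. -/
theorem sum_mass_le (θ : ℝ → ℝ) (hθ0 : ∀ t, 0 ≤ θ t) (hθ1 : ∀ t, θ t ≤ 1) (hθm : Continuous θ)
    (hθs : ∀ (M : ℕ) (t : ℝ), ∑ k ∈ Finset.range (2 * M + 1), θ (t - ((k : ℝ) - M)) ≤ 1)
    {g : ℝ × ℝ → ℂ} (hgi : Integrable g) (h : ℝ) (M : ℕ) :
    (∀ a b : ℝ, Integrable fun q : ℝ × ℝ => ((θ (q.1 / h - a) * θ (q.2 / h - b) : ℝ) : ℂ) * g q) ∧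
    ∑ p ∈ Finset.range (2 * M + 1) ×ˢ Finset.range (2 * M + 1),
        ∫ q : ℝ × ℝ, ‖((θ (q.1 / h - ((p.1 : ℝ) - M)) * θ (q.2 / h - ((p.2 : ℝ) - M)) : ℝ) : ℂ) * g q‖ ≤
      ∫ q, ‖g q‖ := by
  have hnorm : ∀ (a b : ℝ) (q : ℝ × ℝ), ‖((θ (q.1 / h - a) * θ (q.2 / h - b) : ℝ) : ℂ) * g q‖ =
      θ (q.1 / h - a) * θ (q.2 / h - b) * ‖g q‖ := fun a b q => by
    rw [norm_mul, Complex.norm_real, Real.norm_of_nonneg (mul_nonneg (hθ0 _) (hθ0 _))]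
  have hint : ∀ a b : ℝ, Integrable fun q : ℝ × ℝ => ((θ (q.1 / h - a) * θ (q.2 / h - b) : ℝ) : ℂ) * g q := by
    intro a b
    refine hgi.bdd_mul (c := 1) (Continuous.aestronglyMeasurable (by fun_prop)) (ae_of_all _ fun q => ?_)
    rw [Complex.norm_real, Real.norm_of_nonneg (mul_nonneg (hθ0 _) (hθ0 _))]
    exact mul_le_one₀ (hθ1 _) (hθ0 _) (hθ1 _)
  refine ⟨hint, ?_⟩
  rw [← integral_finsetSum _ (fun p _ => (hint _ _).norm)]
  refine integral_mono (integrable_finsetSum _ fun p _ => (hint _ _).norm) hgi.norm fun q => ?_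
  simp only [hnorm]
  rw [Finset.sum_product]
  have hfac : ∑ k ∈ Finset.range (2 * M + 1), ∑ l ∈ Finset.range (2 * M + 1),
      θ (q.1 / h - ((k : ℝ) - M)) * θ (q.2 / h - ((l : ℝ) - M)) * ‖g q‖ =
      (∑ k ∈ Finset.range (2 * M + 1), θ (q.1 / h - ((k : ℝ) - M))) *
        (∑ l ∈ Finset.range (2 * M + 1), θ (q.2 / h - ((l : ℝ) - M))) * ‖g q‖ := by
    rw [Finset.sum_mul_sum, Finset.sum_mul]
    refine Finset.sum_congr rfl fun k _ => ?_
    rw [Finset.sum_mul]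
  rw [hfac]
  have h0 : 0 ≤ ∑ l ∈ Finset.range (2 * M + 1), θ (q.2 / h - ((l : ℝ) - M)) :=
    Finset.sum_nonneg fun l _ => hθ0 _
  exact mul_le_of_le_one_left (norm_nonneg _) (mul_le_one₀ (hθs M _) h0 (hθs M _))

/-- **Triangle inequality for field vectors of finite sums**: `‖Ψ_{∑ Tᵢ}‖ ≤ ∑ ‖Ψ_{Tᵢ}‖`. -/
theorem norm_fieldVec_sum_le {S : SchwingerFamily E4} (hS : OSReconstructionNoE1 S.toLabelled) {N : ℕ}
    {ι : Type*} (s : Finset ι) (T : ι → 𝓢((Fin N → E4), ℂ)) (hT : ∀ i, IsTimeOrdered (T i))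
    (hs : IsTimeOrdered (∑ i ∈ s, T i)) :
    ‖hS.fieldVec N (fun _ => ()) (∑ i ∈ s, T i) hs‖ ≤ ∑ i ∈ s, ‖hS.fieldVec N (fun _ => ()) (T i) (hT i)‖ := by
  have heq : (∑ i ∈ s, T i) = ∑ i ∈ s, (1 : ℂ) • T i := by simp
  have hs' : IsTimeOrdered (∑ i ∈ s, (1 : ℂ) • T i) := heq ▸ hs
  rw [fieldVec_congr hS heq hs hs', fieldVec_finset_sum hS s (fun _ => (1 : ℂ)) T hT hs']
  simp only [one_smul]
  exact norm_sum_le _ _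

/-- **Compactly supported cut-offs of a time-ordered cloud**: `W_K = χ_K W` with smooth compactly supported
`χ_K : (ℝ⁴)ⁿ → [0,1]`, eventually `1` at every point (`Mopup.exists_smooth_exhaustion` of the whole space); the
`W_K` are Schwartz, time-ordered and compactly supported. -/
theorem exists_cutoff_clouds {n : ℕ} (W : 𝓢((Fin n → E4), ℂ)) (hW : IsTimeOrdered W) :
    ∃ (χ : ℕ → (Fin n → E4) → ℝ) (WK : ℕ → 𝓢((Fin n → E4), ℂ)),
      (∀ K y, WK K y = (χ K y : ℂ) * W y) ∧ (∀ K, IsTimeOrdered (WK K)) ∧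
      (∀ K, HasCompactSupport ((WK K : 𝓢((Fin n → E4), ℂ)) : (Fin n → E4) → ℂ)) ∧
      (∀ K y, 0 ≤ χ K y ∧ χ K y ≤ 1) ∧ (∀ y, ∀ᶠ K in atTop, χ K y = 1) := by
  obtain ⟨χ, hχs, hχc, -, hχ01, hχ1, -⟩ :=
    Summit.QuantumFields.YangMills.Theorems.NPointIsotropy.ComplexRotationBandlimit.Mopup.exists_smooth_exhaustion
      (isOpen_univ : IsOpen (Set.univ : Set (Fin n → E4)))
  have hcs : ∀ K, HasCompactSupport fun y : Fin n → E4 => (χ K y : ℂ) * W y := fun K =>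
    ((hχc K).comp_left Complex.ofReal_zero).mul_right
  have hsm : ∀ K, ContDiff ℝ ∞ fun y : Fin n → E4 => (χ K y : ℂ) * W y := fun K =>
    (Complex.ofRealCLM.contDiff.comp (hχs K)).mul (W.smooth _)
  refine ⟨χ, fun K => (hcs K).toSchwartzMap (hsm K), fun K y => rfl, fun K => ?_, fun K => hcs K, hχ01,
    fun y => hχ1 y (Set.mem_univ y)⟩
  intro y hy
  have hy' : y ∈ tsupport (fun y : Fin n → E4 => (χ K y : ℂ) * W y) := hy
  exact hW (tsupport_mul_subset_right hy')

end DiagOfBoxes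

/-- **Registered helper package `stub_diagOfBoxesHelpers`** of stub (F) `stub_diagOfBoxes` (line `Sketch`): the conjunction
of `DiagOfBoxes.isTimeOrdered_insertion` (windowed insertions in front of translated time-ordered clouds are time-ordered)
and `DiagOfBoxes.tendsto_norm_fieldVec` (norms of regularised field vectors converge under `NPointRegular`). -/
theorem stub_diagOfBoxesHelpers :
    open Literature.MathematicalPhysics.QuantumLattice Literature.MathematicalPhysics.AQFT
      Literature.MathematicalPhysics.QuantumFieldTheory
      Summit.QuantumFields.YangMills.Theorems.NPointIsotropy.Negative in
    (∀ (u v : ℝ), 0 < u → 0 < v → ∀ (f : SchwartzMap (Fin 1 → E4) ℂ),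
      tsupport (f : (Fin 1 → E4) → ℂ) ⊆ {x | u ≤ x 0 0 ∧ x 0 0 ≤ 2 * u} →
      ∀ (m : ℕ) (W : SchwartzMap (Fin m → E4) ℂ), IsTimeOrdered W →
        IsTimeOrdered (f.appendTensor (translateMulti ((2 * u + v) • EuclideanSpace.single 0 1) W))) ∧
    (∀ (S : SchwingerFamily E4) (hS : OSReconstructionNoE1 S.toLabelled), NPointRegular S →
      ∀ (m : ℕ) (A : SchwartzMap (Fin m → E4) ℂ) (hA : IsTimeOrdered A) (Ak : ℕ → SchwartzMap (Fin m → E4) ℂ)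
        (hAk : ∀ k, IsTimeOrdered (Ak k)) (a : ℕ → (Fin m → E4) → ℝ),
        (∀ k x, Ak k x = (a k x : ℂ) * A x) → (∀ k x, 0 ≤ a k x ∧ a k x ≤ 1) →
        (∀ x, Filter.Eventually (fun k => a k x = 1) Filter.atTop) →
        Filter.Tendsto (fun k => ‖hS.fieldVec m (fun _ => ()) (Ak k) (hAk k)‖) Filter.atTop
          (nhds ‖hS.fieldVec m (fun _ => ()) A hA‖)) :=
  ⟨fun _ _ hu hv _ hf _ _ hW => DiagOfBoxes.isTimeOrdered_insertion hu hv hf hW,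
    fun S hS hreg _ _ hA Ak hAk a ha ha01 ha1 => DiagOfBoxes.tendsto_norm_fieldVec S hS hreg hA Ak hAk a ha ha01 ha1⟩

end Summit.QuantumFields.YangMills.Theorems.SoftKernelBoostCovariance.Sketch

end
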